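import Summits.Ventures.CertifiedManyBodySolver.Downfold.EmeryAxialSlabYBCO7PlaneWindows
import Summits.Ventures.CertifiedManyBodySolver.Downfold.EmeryFermiFillingYBCO7Plane
import Summits.Ventures.CertifiedManyBodySolver.Downfold.EmeryFermiFillingLa214
import Summits.Ventures.CertifiedManyBodySolver.Downfold.EmeryAxialConductionBand
import HarnessLib

/-!
# YBa₂Cu₃O₇ CuO₂ PLANE (box #18Y YBCO7, (K) plane-slice source rows): the axial co-shift census ON THE TYPED BOX `emeryBoxYBCO7planeY6K26Src` — verdicts against the object-E row
# `t′/t ∈ [-0.63, -0.44]` and their FOUR-ORBITAL reading (companion of `EmeryAxialSlabYBCO7PlaneWindows`, which carries the method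
# docstring, the slab table and the raw slab windows; the kernel certificates are in `EmeryAxialSlabYBCO7PlaneSubs*`)

Venture CertifiedManyBodySolver, cell `pub/hubbard-downfold` (stage S1), seat hubbard-downfold-mod-4 (technique B); namespace
`Summit.Ventures.CertifiedManyBodySolver.Downfold.Emery`. Everything PROVED. READING (certified): `a ∈ [0, 0.35]` ⇒ the co-shifted Fermi surface is STILL LESS cuprate-like than the E row (`t′/t > -0.44`): the REQUIRED axial admixture at the Fermi level is `a_F > 0.35` eV (`emeryBoxYBCO7planeY6K26Src_axial_short`).
WHAT THIS IS NOT: not a statement that the material's parameters ARE in the box (SCREENING-GRADE provenance); `U = 0` band kinematics; no phase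
sentence; the E row is a [float] literature refit; `a_F` is the ADDITIONAL admixture beyond the box's σ rows (a model-form distance).
Sources: [AndersenEtAl1995, §§5–6]; [PavariniEtAl2001, Eqs. (1)–(3), Fig. 3]; [HybertsenSchluterChristensen1989, Eq. (1)].
-/

noncomputable section

namespace Summit.Ventures.CertifiedManyBodySolver.Downfold.Emery

open Real Set
open Summit.Ventures.CertifiedManyBodySolver.Downfold

/-! ## §2 The typed box and the co-shift as a parameter -/

/-- The one-body rows and the per-spin filling of `emeryBoxYBCO7planeY6K26Src` read by this file. [folklore] -/
theorem emeryBoxYBCO7planeY6K26Src_axRows {p : EmeryCoord → ℝ} (hp : emeryBoxYBCO7planeY6K26Src.Mem p) :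
    p .DeltaPd ∈ Set.Icc (7 / 4 : ℝ) (47 / 20 : ℝ) ∧ p .tpd ∈ Set.Icc (117 / 100 : ℝ) (139 / 100 : ℝ) ∧
      p .tpp ∈ Set.Icc (61 / 100 : ℝ) (73 / 100 : ℝ) ∧ p .tppP ∈ Set.Icc (3 / 20 : ℝ) (3 / 20 : ℝ) ∧
      (2 - p .nHoles) / 2 ∈ Set.Icc (167 / 400 : ℝ) (21 / 50 : ℝ) := by
  obtain ⟨hΔ, ha, hb, hc, hn⟩ := emeryBoxYBCO7planeY6K26Src_mem_rows hp
  exact ⟨hΔ, ha, hb, hc, abFilling_rowYBCO7Plane_of_nHoles hn.1 hn.2 rfl⟩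

/-- **Slab 0 on the typed box**: for every parameter vector of `emeryBoxYBCO7planeY6K26Src`, every co-shift `a ∈ [0, 0.1]` and every Fermi energy at
which the CO-SHIFTED σ antibonding band holds the box's electrons: `ε ∈ [1.14, 2.2]`, `t′/t ∈ [-0.3615, -0.2514]` (SHORT).
[folklore] -/
theorem emeryBoxYBCO7planeY6K26Src_axSlab0 :
    HoldsOn (fun p : EmeryCoord → ℝ => ∀ a ε : ℝ, a ∈ Set.Icc (0 : ℝ) (1 / 10 : ℝ) →
      abFilling (p .DeltaPd) (p .tpd) (p .tpp + a) (p .tppP + a) ε = (2 - p .nHoles) / 2 →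
      ε ∈ Set.Icc (57 / 50 : ℝ) (11 / 5 : ℝ) ∧
      fsRatio (p .DeltaPd) (p .tpd) (p .tpp + a) (p .tppP + a) ε ∈ Set.Icc (-(723 / 2000 : ℝ)) (-(1257 / 5000 : ℝ))) emeryBoxYBCO7planeY6K26Src := by
  intro p hp a ε ha' hf
  obtain ⟨hΔ, ha, hb, hc, hν⟩ := emeryBoxYBCO7planeY6K26Src_axRows hp
  rw [← hf] at hν
  exact ybco7PlaneAxSlab0_window hΔ ha ⟨by linarith [hb.1, ha'.1], by linarith [hb.2, ha'.2]⟩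
    ⟨by linarith [hc.1, ha'.1], by linarith [hc.2, ha'.2]⟩ hν

/-- **Slab 1 on the typed box**: for every parameter vector of `emeryBoxYBCO7planeY6K26Src`, every co-shift `a ∈ [0.1, 0.2]` and every Fermi energy at
which the CO-SHIFTED σ antibonding band holds the box's electrons: `ε ∈ [1.1, 2.14]`, `t′/t ∈ [-0.3981, -0.2951]` (SHORT).
[folklore] -/
theorem emeryBoxYBCO7planeY6K26Src_axSlab1 :
    HoldsOn (fun p : EmeryCoord → ℝ => ∀ a ε : ℝ, a ∈ Set.Icc (1 / 10 : ℝ) (1 / 5 : ℝ) →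
      abFilling (p .DeltaPd) (p .tpd) (p .tpp + a) (p .tppP + a) ε = (2 - p .nHoles) / 2 →
      ε ∈ Set.Icc (11 / 10 : ℝ) (107 / 50 : ℝ) ∧
      fsRatio (p .DeltaPd) (p .tpd) (p .tpp + a) (p .tppP + a) ε ∈ Set.Icc (-(3981 / 10000 : ℝ)) (-(2951 / 10000 : ℝ))) emeryBoxYBCO7planeY6K26Src := by
  intro p hp a ε ha' hf
  obtain ⟨hΔ, ha, hb, hc, hν⟩ := emeryBoxYBCO7planeY6K26Src_axRows hp
  rw [← hf] at hν
  exact ybco7PlaneAxSlab1_window hΔ ha ⟨by linarith [hb.1, ha'.1], by linarith [hb.2, ha'.2]⟩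
    ⟨by linarith [hc.1, ha'.1], by linarith [hc.2, ha'.2]⟩ hν

/-- **Slab 2 on the typed box**: for every parameter vector of `emeryBoxYBCO7planeY6K26Src`, every co-shift `a ∈ [0.2, 0.25]` and every Fermi energy at
which the CO-SHIFTED σ antibonding band holds the box's electrons: `ε ∈ [1.1, 2.04]`, `t′/t ∈ [-0.4112, -0.3271]` (SHORT).
[folklore] -/
theorem emeryBoxYBCO7planeY6K26Src_axSlab2 :
    HoldsOn (fun p : EmeryCoord → ℝ => ∀ a ε : ℝ, a ∈ Set.Icc (1 / 5 : ℝ) (1 / 4 : ℝ) →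
      abFilling (p .DeltaPd) (p .tpd) (p .tpp + a) (p .tppP + a) ε = (2 - p .nHoles) / 2 →
      ε ∈ Set.Icc (11 / 10 : ℝ) (51 / 25 : ℝ) ∧
      fsRatio (p .DeltaPd) (p .tpd) (p .tpp + a) (p .tppP + a) ε ∈ Set.Icc (-(257 / 625 : ℝ)) (-(3271 / 10000 : ℝ))) emeryBoxYBCO7planeY6K26Src := by
  intro p hp a ε ha' hf
  obtain ⟨hΔ, ha, hb, hc, hν⟩ := emeryBoxYBCO7planeY6K26Src_axRows hp
  rw [← hf] at hν
  exact ybco7PlaneAxSlab2_window hΔ ha ⟨by linarith [hb.1, ha'.1], by linarith [hb.2, ha'.2]⟩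
    ⟨by linarith [hc.1, ha'.1], by linarith [hc.2, ha'.2]⟩ hν

/-- **Slab 3 on the typed box**: for every parameter vector of `emeryBoxYBCO7planeY6K26Src`, every co-shift `a ∈ [0.25, 0.3]` and every Fermi energy at
which the CO-SHIFTED σ antibonding band holds the box's electrons: `ε ∈ [1.08, 2.0]`, `t′/t ∈ [-0.4255, -0.3411]` (SHORT).
[folklore] -/
theorem emeryBoxYBCO7planeY6K26Src_axSlab3 :
    HoldsOn (fun p : EmeryCoord → ℝ => ∀ a ε : ℝ, a ∈ Set.Icc (1 / 4 : ℝ) (3 / 10 : ℝ) →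
      abFilling (p .DeltaPd) (p .tpd) (p .tpp + a) (p .tppP + a) ε = (2 - p .nHoles) / 2 →
      ε ∈ Set.Icc (27 / 25 : ℝ) (2 : ℝ) ∧
      fsRatio (p .DeltaPd) (p .tpd) (p .tpp + a) (p .tppP + a) ε ∈ Set.Icc (-(851 / 2000 : ℝ)) (-(3411 / 10000 : ℝ))) emeryBoxYBCO7planeY6K26Src := by
  intro p hp a ε ha' hf
  obtain ⟨hΔ, ha, hb, hc, hν⟩ := emeryBoxYBCO7planeY6K26Src_axRows hp
  rw [← hf] at hν
  exact ybco7PlaneAxSlab3_window hΔ ha ⟨by linarith [hb.1, ha'.1], by linarith [hb.2, ha'.2]⟩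
    ⟨by linarith [hc.1, ha'.1], by linarith [hc.2, ha'.2]⟩ hν

/-- **Slab 4 on the typed box**: for every parameter vector of `emeryBoxYBCO7planeY6K26Src`, every co-shift `a ∈ [0.3, 0.35]` and every Fermi energy at
which the CO-SHIFTED σ antibonding band holds the box's electrons: `ε ∈ [1.08, 1.98]`, `t′/t ∈ [-0.4385, -0.3534]` (SHORT).
[folklore] -/
theorem emeryBoxYBCO7planeY6K26Src_axSlab4 :
    HoldsOn (fun p : EmeryCoord → ℝ => ∀ a ε : ℝ, a ∈ Set.Icc (3 / 10 : ℝ) (7 / 20 : ℝ) →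
      abFilling (p .DeltaPd) (p .tpd) (p .tpp + a) (p .tppP + a) ε = (2 - p .nHoles) / 2 →
      ε ∈ Set.Icc (27 / 25 : ℝ) (99 / 50 : ℝ) ∧
      fsRatio (p .DeltaPd) (p .tpd) (p .tpp + a) (p .tppP + a) ε ∈ Set.Icc (-(877 / 2000 : ℝ)) (-(1767 / 5000 : ℝ))) emeryBoxYBCO7planeY6K26Src := by
  intro p hp a ε ha' hf
  obtain ⟨hΔ, ha, hb, hc, hν⟩ := emeryBoxYBCO7planeY6K26Src_axRows hp
  rw [← hf] at hν
  exact ybco7PlaneAxSlab4_window hΔ ha ⟨by linarith [hb.1, ha'.1], by linarith [hb.2, ha'.2]⟩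
    ⟨by linarith [hc.1, ha'.1], by linarith [hc.2, ha'.2]⟩ hν

/-- **Slab 5 on the typed box**: for every parameter vector of `emeryBoxYBCO7planeY6K26Src`, every co-shift `a ∈ [0.35, 0.4]` and every Fermi energy at
which the CO-SHIFTED σ antibonding band holds the box's electrons: `ε ∈ [1.06, 1.96]`, `t′/t ∈ [-0.4504, -0.3651]` (MEETS).
[folklore] -/
theorem emeryBoxYBCO7planeY6K26Src_axSlab5 :
    HoldsOn (fun p : EmeryCoord → ℝ => ∀ a ε : ℝ, a ∈ Set.Icc (7 / 20 : ℝ) (2 / 5 : ℝ) →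
      abFilling (p .DeltaPd) (p .tpd) (p .tpp + a) (p .tppP + a) ε = (2 - p .nHoles) / 2 →
      ε ∈ Set.Icc (53 / 50 : ℝ) (49 / 25 : ℝ) ∧
      fsRatio (p .DeltaPd) (p .tpd) (p .tpp + a) (p .tppP + a) ε ∈ Set.Icc (-(563 / 1250 : ℝ)) (-(3651 / 10000 : ℝ))) emeryBoxYBCO7planeY6K26Src := by
  intro p hp a ε ha' hf
  obtain ⟨hΔ, ha, hb, hc, hν⟩ := emeryBoxYBCO7planeY6K26Src_axRows hp
  rw [← hf] at hν
  exact ybco7PlaneAxSlab5_window hΔ ha ⟨by linarith [hb.1, ha'.1], by linarith [hb.2, ha'.2]⟩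
    ⟨by linarith [hc.1, ha'.1], by linarith [hc.2, ha'.2]⟩ hν

/-- **Slab 6 on the typed box**: for every parameter vector of `emeryBoxYBCO7planeY6K26Src`, every co-shift `a ∈ [0.4, 0.5]` and every Fermi energy at
which the CO-SHIFTED σ antibonding band holds the box's electrons: `ε ∈ [1.02, 1.98]`, `t′/t ∈ [-0.4767, -0.3749]` (MEETS).
[folklore] -/
theorem emeryBoxYBCO7planeY6K26Src_axSlab6 :
    HoldsOn (fun p : EmeryCoord → ℝ => ∀ a ε : ℝ, a ∈ Set.Icc (2 / 5 : ℝ) (1 / 2 : ℝ) →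
      abFilling (p .DeltaPd) (p .tpd) (p .tpp + a) (p .tppP + a) ε = (2 - p .nHoles) / 2 →
      ε ∈ Set.Icc (51 / 50 : ℝ) (99 / 50 : ℝ) ∧
      fsRatio (p .DeltaPd) (p .tpd) (p .tpp + a) (p .tppP + a) ε ∈ Set.Icc (-(4767 / 10000 : ℝ)) (-(3749 / 10000 : ℝ))) emeryBoxYBCO7planeY6K26Src := by
  intro p hp a ε ha' hf
  obtain ⟨hΔ, ha, hb, hc, hν⟩ := emeryBoxYBCO7planeY6K26Src_axRows hp
  rw [← hf] at hν
  exact ybco7PlaneAxSlab6_window hΔ ha ⟨by linarith [hb.1, ha'.1], by linarith [hb.2, ha'.2]⟩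
    ⟨by linarith [hc.1, ha'.1], by linarith [hc.2, ha'.2]⟩ hν

/-! ## §3 The census verdicts against the E row -/

/-- **STILL SHORT OF THE E ROW for every co-shift `a ∈ [0, 0.35]`**: the co-shifted σ (= four-orbital at the Fermi level) `t′/t` stays ABOVE
`-0.44` — the one-band Fermi surface of record REQUIRES an axial admixture `a_F > 0.35` eV beyond the box's σ rows. [folklore] -/
theorem emeryBoxYBCO7planeY6K26Src_axial_short :
    HoldsOn (fun p : EmeryCoord → ℝ => ∀ a ε : ℝ, a ∈ Set.Icc (0 : ℝ) (7 / 20 : ℝ) →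
      abFilling (p .DeltaPd) (p .tpd) (p .tpp + a) (p .tppP + a) ε = (2 - p .nHoles) / 2 →
      (-(11 / 25 : ℝ)) < fsRatio (p .DeltaPd) (p .tpd) (p .tpp + a) (p .tppP + a) ε) emeryBoxYBCO7planeY6K26Src := by
  intro p hp a ε ha' hf
  rcases mem_Icc_split ha' (1 / 5 : ℝ) with ha' | ha'
  · rcases mem_Icc_split ha' (1 / 10 : ℝ) with ha' | ha'
    · have h := (emeryBoxYBCO7planeY6K26Src_axSlab0 p hp a ε ha' hf).2
      exact lt_of_lt_of_le (by norm_num) h.1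
    · have h := (emeryBoxYBCO7planeY6K26Src_axSlab1 p hp a ε ha' hf).2
      exact lt_of_lt_of_le (by norm_num) h.1
  · rcases mem_Icc_split ha' (1 / 4 : ℝ) with ha' | ha'
    · have h := (emeryBoxYBCO7planeY6K26Src_axSlab2 p hp a ε ha' hf).2
      exact lt_of_lt_of_le (by norm_num) h.1
    · rcases mem_Icc_split ha' (3 / 10 : ℝ) with ha' | ha'
      · have h := (emeryBoxYBCO7planeY6K26Src_axSlab3 p hp a ε ha' hf).2
        exact lt_of_lt_of_le (by norm_num) h.1
      · have h := (emeryBoxYBCO7planeY6K26Src_axSlab4 p hp a ε ha' hf).2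
        exact lt_of_lt_of_le (by norm_num) h.1

/-! ## §4 The four-orbital reading (transfer theorem `EmeryAxialConductionBand.condFilling_eq_abFilling`) -/

/-- **FOUR-ORBITAL FORM OF THE SHORTFALL.** For every parameter vector of `emeryBoxYBCO7planeY6K26Src`, EVERY axial level `ε_s` and coupling `t_sp`, and every
Fermi energy `ε < ε_s` at which the four-orbital CONDUCTION band (`EmeryBandEigenvalues.band4 … 1`) holds the box's electrons: if the axial admixture
at the Fermi level `t_sp²/(ε_s − ε)` is at most `0.35` eV, the conduction-band Fermi surface (an exact `t–t′` contour,
`EmeryAxialConductionBand.oneBand_of_band4_one_eq`) has `t′/t > -0.44` — it does NOT reproduce the object-E row. [cite: PavariniEtAl2001, Eqs. (1)–(3), Fig. 3] -/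
theorem emeryBoxYBCO7planeY6K26Src_fourOrbital_short :
    HoldsOn (fun p : EmeryCoord → ℝ => ∀ εs tsp ε : ℝ, ε < εs →
      tsp ^ 2 / (εs - ε) ≤ (7 / 20 : ℝ) →
      condFilling (p .DeltaPd) εs (p .tpd) (p .tpp) (p .tppP) tsp ε = (2 - p .nHoles) / 2 →
      (-(11 / 25 : ℝ)) < fsRatio (p .DeltaPd) (p .tpd) (p .tpp + tsp ^ 2 / (εs - ε)) (p .tppP + tsp ^ 2 / (εs - ε)) ε) emeryBoxYBCO7planeY6K26Src := by
  intro p hp εs tsp ε hε ha hf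
  rw [condFilling_eq_abFilling hε] at hf
  exact emeryBoxYBCO7planeY6K26Src_axial_short p hp _ ε ⟨div_nonneg (sq_nonneg _) (sub_pos.mpr hε).le, ha⟩ hf

end Summit.Ventures.CertifiedManyBodySolver.Downfold.Emery
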